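import Summits.HodgeConjecture.HodgeConjecture.Theorems.UeP4bFlatLevelReadingsPins
import Literature.AlgebraicGeometry.HodgeTheory.LineBundleTopologicalEulerClass
import Literature.AlgebraicGeometry.Modules.UnitCocyclePresented
import HarnessLib

/-!
# U-e P4, (N3-core) assembler leaf (A1): the global class of the universal family and its fibre readings

Cell hodgecm-mathlib (D-0151), rung 0 of the Mumford line under `HDel` (item `stmt-HodgeConjecture-24835`), (U)-HEAD third
layer, node U-e, socket P4, (N3-core) assembler socket (R) `UHead.Ue_N3asm_pairReading` (P4 lead B-p03 (g14), sockets of record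
`B-provers/B-p03/Ue-P4-sockets.v0.10.B-p03g14.lean`; cut (A1)/(A2) 16:10:28Z, (A1) spelling 16:12:34Z); hand B-p16 (g12).
THEOREMS ONLY (no definition, no named fact, no instance, no `sorry`); books 0.  HC_CM is proved only modulo the 7 printed
citations until rung 0 closes; nothing here changes that count.

For a Siegel fine moduli scheme `𝓜`, a complex point `t` of `M ⊗ ℂ` and a fibre triple `P′` over `Spec ℂ` with base-change
witnesses `(G, Ĝ)` along the `ℚ`-side reading of `t` ([MumfordFogartyKirwan1994] Def. 7.2/7.3), write
`ι := W1.fibreAVIso P′ ≪≫ (W1.fiberUnivIsoOfIsBaseChangeVia 𝓜 t P′ G Ĝ h)⁻¹ : (P′.A)_𝟙 ≅ X_t` and `e := ι(ℂ)` (the PINNED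
identification of `UeP4bFlatLevelReadingsPins`).

* (A1-sq) `fibreAVIso_fiberUnivIso_inv_fiberι_comp_fst` — the MORPHISM square behind (P2):
  `ι.hom ≫ (X_t → X ⊗ ℂ) ≫ (X ⊗ ℂ → X) = ((P′.A)_𝟙 → P′.A) ≫ G` on underlying schemes;
* (A1-top) `coreEulerClass_fibre_reading` — **the global class and its fibre readings**: for a class `L ∈ Ȟ¹(X, 𝒪_X^×)` of the
  universal abelian scheme `X`, a power `q`, a cocycle `c` on `X ⊗ ℂ` representing `(pr^* L)^q` and a cocycle `c′` on `(P′.A)_𝟙`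
  representing `((fst ≫ G)^* L)^q`, the topological Euler class `e(c) ∈ H²((X ⊗ ℂ)(ℂ); ℂ)` (★ B-p15 (g9) `LineBundleTopologicalEulerClass`,
  any coefficients, here `ℂ` with `m := 1`) restricted to the fibre `X_t(ℂ)` and read through `e` IS `e(c′)` — naturality of the
  Euler class under pull-back of cocycles (★ `UnitCocycle.coreEulerClass_pullback`), its invariance on `CechPic` classes
  (★ `UnitCocycle.coreEulerClass_eq_of_mk_eq`), `CechPic.pullback` a group homomorphism (`map_pow`) and functorial
  (★ `CechPic.pullback_comp`), and (A1-sq).  No additivity of `c₁` is used: the `q`-th power is taken in `CechPic`.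

## References
* [MumfordFogartyKirwan1994] D. Mumford, J. Fogarty, F. Kirwan, *Geometric Invariant Theory*, 3rd ed. (1994), Ch. 7 §2
  Definition 7.2, Definition 7.3 (p. 129), §3 Theorem 7.9 (p. 139).
* [Hartshorne1977] R. Hartshorne, *Algebraic Geometry* (1977), Ch. II Ex. 6.8 (a), Ch. III Ex. 4.5.
* [HusemollerFibreBundles1994] D. Husemöller, *Fibre Bundles*, 3rd ed. (1994), Ch. 17 Prop. 3.3.
* [GortzWedhorn2020] U. Görtz, T. Wedhorn, *Algebraic Geometry I*, 2nd ed. (2020), Prop. 4.16.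
-/

set_option autoImplicit false

-- mandated namespace `Summit.HodgeConjecture.HodgeConjecture.Theorems` trips `linter.dupNamespace` (single-problem summit; the lakefile turns
-- the linter off tree-wide as a weak option), restated here so stand-alone elaboration is warning-free (as in ★ `SiegelUniversalFamilyHodgeFrames`).
set_option linter.dupNamespace false

noncomputable section

open CategoryTheory CategoryTheory.Limits AlgebraicGeometry
open _root_.Topology _root_.Filter

namespace Summit.HodgeConjecture.HodgeConjecture.Theorems

namespace UnivFamilyLDeltaClass

open Literature.AlgebraicGeometry
open Literature.AlgebraicGeometry.Motives
open Literature.AlgebraicGeometry.Modules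
open Literature.AlgebraicGeometry.HodgeTheory
open Literature.AlgebraicGeometry.AbelianSchemes (PolarizedAbelianSchemeWithLevel AbelianSchemeOver)
open Literature.AlgebraicGeometry.ModuliOfAbelianVarieties
open Literature.AlgebraicGeometry.ModuliOfAbelianVarieties.W1
open Literature.AlgebraicTopology.SingularHomology
open Literature.AlgebraicTopology.CharacteristicClasses

variable {g N : ℕ} {δ : Fin g → ℕ} (𝓜 : SiegelFineModuliScheme g N δ)
  (t : ComplexPoints ((Motives.baseChange ℚ ℂ).obj 𝓜.M))
  (P' : PolarizedAbelianSchemeWithLevel g N δ (specOver ℚ ℂ).left)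
  (G : P'.A.X.left ⟶ 𝓜.univ.A.X.left) (Ĝ : P'.D.hat.X.left ⟶ 𝓜.univ.D.hat.X.left)
  (h : P'.IsBaseChangeVia 𝓜.univ ((AlgPoints.baseChangeEquiv (algebraMap ℚ ℂ) 𝓜.M).symm t).left G Ĝ)

/-- **(A1-sq) The scheme square of the pinned identification**: on underlying schemes,
`ι.hom ≫ (X_t ↪ X ⊗ ℂ) ≫ (X ⊗ ℂ → X) = ((P′.A)_𝟙 → P′.A) ≫ G` for `ι := fibreAVIso P′ ≪≫ fiberUnivIso⁻¹` — the identity-fibre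
isomorphism is `pullback.fst` (★ B-p18 `pullbackId_hom_app_left`) and `fiberUnivIso` lies over `G` (★ `fiberOverBaseChangeIsoOfIsPullback_hom_left_comp`).
Its point-level shadow is ★ (P2) `UnivFamilyLevelReadings.left_map_fiberι_pinned_comp_fst`.
[cite: MumfordFogartyKirwan1994, Ch. 7 §2 Definition 7.3 (p. 129)] [cite: GortzWedhorn2020, Prop. 4.16] -/
theorem fibreAVIso_fiberUnivIso_inv_fiberι_comp_fst :
    ((fibreAVIso P' ≪≫ (fiberUnivIsoOfIsBaseChangeVia 𝓜 t P' G Ĝ h).symm).hom).left ≫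
        (fiberι (univFamilyℂ 𝓜) t).left ≫ baseChangeHomFst (algebraMap ℚ ℂ) (univTotal 𝓜) =
      pullback.fst P'.A.X.hom (𝟙 (Spec (CommRingCat.of ℂ))) ≫ G := by
  obtain ⟨w, hpb, -, -⟩ := h.1.1
  have h1 : (fibreAVIso P').hom.left = pullback.fst P'.A.X.hom (𝟙 (Spec (CommRingCat.of ℂ))) :=
    UnivFamilyLevelReadings.pullbackId_hom_app_left _ _
  have h3 : (fiberUnivIsoOfIsBaseChangeVia 𝓜 t P' G Ĝ h).hom.left ≫ G =
      (fiberι (univFamilyℂ 𝓜) t).left ≫ baseChangeHomFst (algebraMap ℚ ℂ) (univTotal 𝓜) :=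
    fiberOverBaseChangeIsoOfIsPullback_hom_left_comp (algebraMap ℚ ℂ) (univFamily 𝓜) t P'.A.X G _
      (AlgPoints.baseChangeEquiv_symm_apply_left (σ := algebraMap ℚ ℂ) (X := 𝓜.M) t).symm hpb
  have h6 : (fiberUnivIsoOfIsBaseChangeVia 𝓜 t P' G Ĝ h).inv.left ≫
      (fiberUnivIsoOfIsBaseChangeVia 𝓜 t P' G Ĝ h).hom.left = 𝟙 _ :=
    congrArg CommaMorphism.left (fiberUnivIsoOfIsBaseChangeVia 𝓜 t P' G Ĝ h).inv_hom_id
  have h5 : (fiberUnivIsoOfIsBaseChangeVia 𝓜 t P' G Ĝ h).inv.left ≫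
      (fiberι (univFamilyℂ 𝓜) t).left ≫ baseChangeHomFst (algebraMap ℚ ℂ) (univTotal 𝓜) = G :=
    calc (fiberUnivIsoOfIsBaseChangeVia 𝓜 t P' G Ĝ h).inv.left ≫
          (fiberι (univFamilyℂ 𝓜) t).left ≫ baseChangeHomFst (algebraMap ℚ ℂ) (univTotal 𝓜)
          = (fiberUnivIsoOfIsBaseChangeVia 𝓜 t P' G Ĝ h).inv.left ≫
            ((fiberUnivIsoOfIsBaseChangeVia 𝓜 t P' G Ĝ h).hom.left ≫ G) := by rw [h3]; rfl
      _ = ((fiberUnivIsoOfIsBaseChangeVia 𝓜 t P' G Ĝ h).inv.left ≫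
            (fiberUnivIsoOfIsBaseChangeVia 𝓜 t P' G Ĝ h).hom.left) ≫ G := (Category.assoc _ _ _).symm
      _ = 𝟙 _ ≫ G := congrArg (· ≫ G) h6
      _ = G := Category.id_comp G
  simp only [Iso.trans_hom, Iso.symm_hom, Over.comp_left, Category.assoc]
  erw [h5, h1]
  rfl

/-- **(A1-top) The global class and its fibre readings.**  For a class `L ∈ Ȟ¹(X, 𝒪^×)` on the universal abelian scheme `X`, a
power `q`, a cocycle `c` on `X ⊗ ℂ` with `[c] = (pr^* L)^q` (`pr : X ⊗ ℂ → X`) and a cocycle `c′` on the identity fibre `(P′.A)_𝟙`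
with `[c′] = ((fst ≫ G)^* L)^q`: the Euler class `e(c) ∈ H²((X ⊗ ℂ)(ℂ); ℂ)` (coefficient `m := 1`) restricted to the fibre `X_t(ℂ)`
and read through `e = ι(ℂ)` equals `e(c′)` — ★ `UnitCocycle.coreEulerClass_pullback` along `ι.hom ≫ (X_t ↪ X ⊗ ℂ)`, ★
`UnitCocycle.coreEulerClass_eq_of_mk_eq`, `CechPic.pullback` multiplicative and functorial (★ `CechPic.pullback_comp`), and (A1-sq).
No `c₁`-additivity: the power lives in `CechPic`. [cite: Hartshorne1977, Ch. II Ex. 6.8 (a) and Ch. III Ex. 4.5]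
[cite: HusemollerFibreBundles1994, Ch. 17 Prop. 3.3] [cite: MumfordFogartyKirwan1994, Ch. 7 §2 Definition 7.3 (p. 129)] -/
theorem coreEulerClass_fibre_reading
    [T2Space (ComplexPoints ((Motives.baseChange ℚ ℂ).obj (univTotal 𝓜)))]
    [ParacompactSpace (ComplexPoints ((Motives.baseChange ℚ ℂ).obj (univTotal 𝓜)))]
    [T2Space (ComplexPoints (fibreAV P').X)] [ParacompactSpace (ComplexPoints (fibreAV P').X)]
    (L : CechPic 𝓜.univ.A.X.left) (q : ℕ)
    (c : UnitCocycle ((Motives.baseChange ℚ ℂ).obj (univTotal 𝓜)).left) (c' : UnitCocycle (fibreAV P').X.left)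
    (hc : CechPic.mk c = CechPic.pullback (baseChangeHomFst (algebraMap ℚ ℂ) (univTotal 𝓜)) L ^ q)
    (hc' : CechPic.mk c' = CechPic.pullback (pullback.fst P'.A.X.hom (𝟙 (Spec (CommRingCat.of ℂ))) ≫ G) L ^ q) :
    singularCohomology.map ℂ ℂ
        ((AlgPoints.homeomorphOfIso (L := ℂ)
            (fibreAVIso P' ≪≫ (fiberUnivIsoOfIsBaseChangeVia 𝓜 t P' G Ĝ h).symm) :
            ComplexPoints (fibreAV P').X ≃ₜ ComplexPoints (fiberOver (univFamilyℂ 𝓜) t)) :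
          C(ComplexPoints (fibreAV P').X, ComplexPoints (fiberOver (univFamilyℂ 𝓜) t))) 2
        (complexBetti.map (fiberι (univFamilyℂ 𝓜) t) 2
          (eulerClass ℂ c.complexCore.Fiber (Module.finrank_self ℂ) ℂ 1)) =
      eulerClass ℂ c'.complexCore.Fiber (Module.finrank_self ℂ) ℂ 1 := by
  -- `e = ι(ℂ)` as a continuous map is `mapContinuous ι.hom`
  have hcoe : ((AlgPoints.homeomorphOfIso (L := ℂ)
        (fibreAVIso P' ≪≫ (fiberUnivIsoOfIsBaseChangeVia 𝓜 t P' G Ĝ h).symm) :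
        ComplexPoints (fibreAV P').X ≃ₜ ComplexPoints (fiberOver (univFamilyℂ 𝓜) t)) :
        C(ComplexPoints (fibreAV P').X, ComplexPoints (fiberOver (univFamilyℂ 𝓜) t))) =
      AlgPoints.mapContinuous (L := ℂ) (fibreAVIso P' ≪≫ (fiberUnivIsoOfIsBaseChangeVia 𝓜 t P' G Ĝ h).symm).hom :=
    rfl
  rw [hcoe]
  -- restriction to the fibre followed by `ι(ℂ)` is pull-back along `ι.hom ≫ (X_t ↪ X ⊗ ℂ)`
  have hcomp : singularCohomology.map ℂ ℂ
        (AlgPoints.mapContinuous (L := ℂ) (fibreAVIso P' ≪≫ (fiberUnivIsoOfIsBaseChangeVia 𝓜 t P' G Ĝ h).symm).hom) 2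
        (complexBetti.map (fiberι (univFamilyℂ 𝓜) t) 2
          (eulerClass ℂ c.complexCore.Fiber (Module.finrank_self ℂ) ℂ 1)) =
      singularCohomology.map ℂ ℂ
        (AlgPoints.mapContinuous (L := ℂ)
          ((fibreAVIso P' ≪≫ (fiberUnivIsoOfIsBaseChangeVia 𝓜 t P' G Ĝ h).symm).hom ≫ fiberι (univFamilyℂ 𝓜) t)) 2
        (eulerClass ℂ c.complexCore.Fiber (Module.finrank_self ℂ) ℂ 1) := by
    change (complexBetti.map (fiberι (univFamilyℂ 𝓜) t) 2 ≫
        complexBetti.map ((fibreAVIso P' ≪≫ (fiberUnivIsoOfIsBaseChangeVia 𝓜 t P' G Ĝ h).symm).hom) 2) _ =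
      complexBetti.map (((fibreAVIso P' ≪≫ (fiberUnivIsoOfIsBaseChangeVia 𝓜 t P' G Ĝ h).symm).hom) ≫
        fiberι (univFamilyℂ 𝓜) t) 2 _
    rw [← complexBetti.map_comp]
  rw [hcomp, ← UnitCocycle.coreEulerClass_pullback]
  -- the two cocycles on `(P′.A)_𝟙` have the same class
  refine UnitCocycle.coreEulerClass_eq_of_mk_eq ℂ ?_ 1
  rw [hc', ← CechPic.pullback_mk, hc]
  erw [MonoidHom.map_pow, ← CechPic.pullback_comp]
  congr 2
  rw [Over.comp_left, Category.assoc]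
  exact congrArg CechPic.pullback (fibreAVIso_fiberUnivIso_inv_fiberι_comp_fst 𝓜 t P' G Ĝ h)

end UnivFamilyLDeltaClass

end Summit.HodgeConjecture.HodgeConjecture.Theorems

end
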